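import Summits.CriticalPhenomena.CardyFormulaZ2.Theorems.CardyUniqueLimitCardyRigidityFaceHalfPlaneG2LengthArea
import Mathlib.MeasureTheory.Measure.Lebesgue.VolumeOfBalls
import HarnessLib

/-!
# A far level cross-cut: the analytic half of Kemppainen–Smirnov's single-annulus transfer
(line `crossing-martingale`, crux `CardyRigidity`, stub A2″ `stub_percFaceHalfPlaneG2`, input (T1))

Crux `Summit.CriticalPhenomena.CardyFormulaZ2.Theses.CardyUniqueLimit.CardyRigidity`
(stmt-CriticalPhenomena-0746), line `crossing_martingale`.  Input (T1) of the deterministic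
predicate `Driver.PercFaceAnnulusTransfer` of stub A2″ (`…FaceHalfPlaneG2OfTransfer.lean`) is
Kemppainen–Smirnov's single-annulus transfer (Ann. Probab. 45 (2017), §2.2, proof of
Prop. 2.5/2.6, "(G2) ⇒ (C2) with `M = 4(C+1)²`"), in the level-set form: among the images
`β_u = f(S(c, u) ∩ ℍ)`, `u ∈ (r, Cr)`, of the concentric upper semicircles of a half-annulus under
a conformal map `f` of `ℍ`, once `log C` exceeds an explicit multiple of `(C'+1)²`, some `β_u`
stays at distance `> (C'+1) d` from any given point `x`, provided all `β_u` have diameter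
`≥ d/2` — so that, taking `x` on a level cross-cut of near-minimal diameter `≤ d`, two level
cross-cuts are `C' d` apart and EVERY curve crossing the half-annulus has `f`-image crossing
the round annulus `A(x, d, C'd)` (intermediate values of `|· - c|`; no planar topology).

* `FarCrosscut.exists_forall_lt_dist` / `faceG2_farCrosscut_of_log_lt` (registered glue
  sub-goal) — the statement above with the constant
  `log C > 2π²/log(4/3) + 36π²(C'+1)²`.  PROOF (Kemppainen–Smirnov's two metrics): if every
  `β_u` met `B̄(x, K)`, `K = (C'+1)d`, split the radii into those whose `β_u` leaves
  `B̄(x, 2K)` — they cross the annulus `A(x, 3K/2, 2K)`, so have logarithmic measure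
  `≤ 2π²/log(4/3)` by the tree's logarithmic length–area inequality
  `AnnulusCrossing.lintegral_inv_le_of_forall_crossing` — and those whose `β_u` stays in
  `B(x, 3K)` with two points `d/2` apart — logarithmic measure `≤ π · area B(x,3K) / (d/2)² =
  36π²(C'+1)²` by the linear one `BallLengthArea.lintegral_inv_mul_le_of_forall_mapsTo_ball`
  (`…FaceHalfPlaneG2LengthArea.lean`); the two measures add up to `∫_r^{Cr} du/u = log C`.

References: A. Kemppainen, S. Smirnov, Ann. Probab. 45 (2017) 698–779, §2.2 (proof of
Prop. 2.5, arXiv numbering) [KemppainenSmirnov2017]; Ch. Pommerenke, *Boundary Behaviour of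
Conformal Maps* (1992), Prop. 2.2 [PommerenkeBBCM1992].
-/

noncomputable section

open Set Filter Metric Topology MeasureTheory Complex Real
open UpperHalfPlane (upperHalfPlaneSet isOpen_upperHalfPlaneSet)
open scoped ENNReal NNReal
open Literature.Analysis.Complex
open Literature.Analysis.Complex.AnnulusCrossing (circleMap_mem_upperHalfPlaneSet
  lintegral_inv_le_of_forall_crossing isOpen_setOf_crossing lintegral_inv_Ioo)

namespace Summit.CriticalPhenomena.CardyFormulaZ2.Cruxes.CardyRigidity.CrossingMartingale

namespace FarCrosscut

variable {f : ℂ → ℂ}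

/-- `volume (B(x, ϱ)) = ofReal (ϱ² π)` in `ℂ` (`ϱ ≥ 0`). [folklore] -/
theorem volume_ball_eq_ofReal (x : ℂ) {ϱ : ℝ} (hϱ : 0 ≤ ϱ) :
    volume (ball x ϱ) = ENNReal.ofReal (ϱ ^ 2 * π) := by
  rw [Complex.volume_ball, ← ENNReal.ofReal_coe_nnreal, NNReal.coe_real_pi,
    ← ENNReal.ofReal_pow hϱ, ← ENNReal.ofReal_mul (by positivity)]

/-- **A far level cross-cut** (analytic half of Kemppainen–Smirnov's single-annulus transfer,
§2.2).  Let `f` be holomorphic and injective on `ℍ`, `c ∈ ℝ`, `r > 0`, `C > 1`, `d > 0`, `C' ≥ 0`, and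
`log C > 2π²/log(4/3) + 36π²(C'+1)²`.  If for every `u ∈ (r, Cr)` the image of the upper
semicircle of radius `u` about `c` contains two points at distance `≥ d/2`, then for every
`x ∈ ℂ` some such image stays at distance `> (C'+1) d` from `x`.
[cite: KemppainenSmirnov2017, §2.2 (proof of Prop. 2.6, (G2) ⇒ (C2))] -/
theorem exists_forall_lt_dist (hf : DifferentiableOn ℂ f upperHalfPlaneSet)
    (hinj : InjOn f upperHalfPlaneSet) {c r C C' d : ℝ} (hr : 0 < r) (hC1 : 1 < C) (hd : 0 < d)
    (hC' : 0 ≤ C') (hC : 2 * π ^ 2 / Real.log (4 / 3) + 36 * π ^ 2 * (C' + 1) ^ 2 < Real.log C)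
    (hdiam : ∀ u ∈ Ioo r (C * r), ∃ θ' ∈ Ioo (0 : ℝ) π, ∃ θ'' ∈ Ioo (0 : ℝ) π,
      d / 2 ≤ dist (f (circleMap (c : ℂ) u θ')) (f (circleMap (c : ℂ) u θ''))) (x : ℂ) :
    ∃ u ∈ Ioo r (C * r), ∀ θ ∈ Ioo (0 : ℝ) π, (C' + 1) * d < dist (f (circleMap (c : ℂ) u θ)) x := by
  by_contra hcon
  push Not at hcon
  -- constants
  set K : ℝ := (C' + 1) * d with hK
  have hK0 : 0 < K := by positivity
  have hlog43 : 0 < Real.log (4 / 3) := Real.log_pos (by norm_num)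
  have hB₁ : 0 ≤ 2 * π ^ 2 / Real.log (4 / 3) := div_nonneg (by positivity) hlog43.le
  have hB₂ : (0 : ℝ) ≤ 36 * π ^ 2 * (C' + 1) ^ 2 := by positivity
  have hrC : r < C * r := by nlinarith
  -- the recentred map
  set g : ℂ → ℂ := fun w ↦ f w - x with hg
  have hgd : DifferentiableOn ℂ g upperHalfPlaneSet := hf.sub_const x
  have hginj : InjOn g upperHalfPlaneSet := fun a ha b hb h ↦ hinj ha hb (sub_left_injective h)
  have hgn : ∀ w, ‖g w‖ = dist (f w) x := fun w ↦ (dist_eq_norm (f w) x).symm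
  -- the two sets of radii
  set T : Set ℝ := {u : ℝ | 0 < u ∧ ∃ θ' ∈ Ioo (0 : ℝ) π, ∃ θ'' ∈ Ioo (0 : ℝ) π,
    ‖g (circleMap (c : ℂ) u θ')‖ < 3 / 2 * K ∧ 2 * K < ‖g (circleMap (c : ℂ) u θ'')‖} with hT
  have hTo : IsOpen T := isOpen_setOf_crossing hgd.continuousOn c (3 / 2 * K) (2 * K)
  set S₁ : Set ℝ := Ioo r (C * r) ∩ T with hS₁
  set S₂ : Set ℝ := Ioo r (C * r) \ T with hS₂
  have hS₁m : MeasurableSet S₁ := measurableSet_Ioo.inter hTo.measurableSet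
  have hS₂m : MeasurableSet S₂ := measurableSet_Ioo.diff hTo.measurableSet
  have hdisj : Disjoint S₁ S₂ := Disjoint.mono_left inter_subset_right disjoint_sdiff_right
  have hI0 : Ioo r (C * r) ⊆ Ioi 0 := fun u hu ↦ hr.trans hu.1
  -- logarithmic measure of `S₁` (the logarithmic metric of the annulus `A(x, 3K/2, 2K)`)
  have h₁ : ∫⁻ u in S₁, ENNReal.ofReal u⁻¹ ≤ ENNReal.ofReal (2 * π ^ 2 / Real.log (4 / 3)) := by
    have h := lintegral_inv_le_of_forall_crossing hgd hginj (R₁ := 3 / 2 * K) (R₂ := 2 * K)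
      (by positivity) (by linarith) (c := c) hS₁m (fun u hu ↦ hI0 hu.1) fun u hu ↦ hu.2.2
    rwa [show 2 * K / (3 / 2 * K) = 4 / 3 by rw [div_eq_iff (by positivity)]; ring] at h
  -- logarithmic measure of `S₂` (the linear metric of the disc `B(x, 3K)`)
  have h₂ : ENNReal.ofReal ((d / 2) ^ 2) * ∫⁻ u in S₂, ENNReal.ofReal u⁻¹ ≤
      ENNReal.ofReal (π * ((3 * K) ^ 2 * π)) := by
    have h := BallLengthArea.lintegral_inv_mul_le_of_forall_mapsTo_ball hf hinj (x := x)
      (ϱ := 3 * K) (c := c) (by positivity : (0 : ℝ) ≤ d / 2) hS₂m (fun u hu ↦ hI0 hu.1) ?_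
    · rwa [volume_ball_eq_ofReal x (by positivity), ← ENNReal.ofReal_mul Real.pi_pos.le] at h
    intro u hu
    have hu0 : 0 < u := hI0 hu.1
    obtain ⟨θ₀, hθ₀, hle⟩ := hcon u hu.1
    have hθ₀' : ‖g (circleMap (c : ℂ) u θ₀)‖ < 3 / 2 * K := by rw [hgn]; linarith
    refine ⟨fun θ hθ ↦ ?_, hdiam u hu.1⟩
    have hnot : ¬ 2 * K < ‖g (circleMap (c : ℂ) u θ)‖ := fun h2 ↦
      hu.2 ⟨hu0, θ₀, hθ₀, θ, hθ, hθ₀', h2⟩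
    rw [mem_ball, ← hgn]
    linarith [not_lt.1 hnot]
  -- add up: `log C ≤ B₁ + B₂`
  have hsplit : ∫⁻ u in Ioo r (C * r), ENNReal.ofReal u⁻¹ =
      (∫⁻ u in S₁, ENNReal.ofReal u⁻¹) + ∫⁻ u in S₂, ENNReal.ofReal u⁻¹ := by
    rw [← lintegral_union hS₂m hdisj, hS₁, hS₂, inter_union_sdiff]
  have hd2 : (0 : ℝ) < (d / 2) ^ 2 := by positivity
  have h₂' : ∫⁻ u in S₂, ENNReal.ofReal u⁻¹ ≤ ENNReal.ofReal (36 * π ^ 2 * (C' + 1) ^ 2) := by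
    have hne : ENNReal.ofReal ((d / 2) ^ 2) ≠ 0 := (ENNReal.ofReal_pos.2 hd2).ne'
    have h3 : ∫⁻ u in S₂, ENNReal.ofReal u⁻¹ ≤
        ENNReal.ofReal (π * ((3 * K) ^ 2 * π)) / ENNReal.ofReal ((d / 2) ^ 2) := by
      rw [ENNReal.le_div_iff_mul_le (Or.inl hne) (Or.inl ENNReal.ofReal_ne_top), mul_comm]
      exact h₂
    refine h3.trans_eq ?_
    rw [← ENNReal.ofReal_div_of_pos hd2]
    congr 1
    rw [div_eq_iff hd2.ne', hK]
    ring
  have htot : ENNReal.ofReal (Real.log C) ≤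
      ENNReal.ofReal (2 * π ^ 2 / Real.log (4 / 3) + 36 * π ^ 2 * (C' + 1) ^ 2) := by
    rw [show Real.log C = Real.log (C * r / r) by rw [mul_div_cancel_right₀ _ hr.ne'],
      ← lintegral_inv_Ioo hr hrC.le, hsplit, ENNReal.ofReal_add hB₁ hB₂]
    exact add_le_add h₁ h₂'
  rw [ENNReal.ofReal_le_ofReal_iff (add_nonneg hB₁ hB₂)] at htot
  linarith

end FarCrosscut

/-- **Registered-shape form** (glue sub-goal `faceG2_farCrosscut_of_log_lt` of
stmt-CriticalPhenomena-0746, the analytic half of input (T1) of `Driver.PercFaceAnnulusTransfer`):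
for `f` holomorphic and injective on `ℍ`, `0 < r`, `1 < C`, `0 < d`, `0 ≤ C'` and
`log C > 2π²/log(4/3) + 36π²(C'+1)²`, if every image of an upper semicircle of radius
`u ∈ (r, Cr)` about the real point `c` contains two points at distance `≥ d/2`, then for every
`x` one of them stays at distance `> (C'+1) d` from `x` (Kemppainen–Smirnov's single-annulus
transfer, level-set form). [cite: KemppainenSmirnov2017, §2.2 (proof of Prop. 2.6, (G2) ⇒ (C2))] -/
theorem faceG2_farCrosscut_of_log_lt : ∀ (f : ℂ → ℂ), DifferentiableOn ℂ f UpperHalfPlane.upperHalfPlaneSet → Set.InjOn f UpperHalfPlane.upperHalfPlaneSet → ∀ (c r C C' d : ℝ), 0 < r → 1 < C → 0 < d → 0 ≤ C' → 2 * Real.pi ^ 2 / Real.log (4 / 3) + 36 * Real.pi ^ 2 * (C' + 1) ^ 2 < Real.log C → (∀ u ∈ Set.Ioo r (C * r), ∃ θ' ∈ Set.Ioo (0 : ℝ) Real.pi, ∃ θ'' ∈ Set.Ioo (0 : ℝ) Real.pi, d / 2 ≤ dist (f (circleMap (c : ℂ) u θ')) (f (circleMap (c : ℂ) u θ''))) →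 ∀ x : ℂ, ∃ u ∈ Set.Ioo r (C * r), ∀ θ ∈ Set.Ioo (0 : ℝ) Real.pi, (C' + 1) * d < dist (f (circleMap (c : ℂ) u θ)) x :=
  fun _ hf hinj _ _ _ _ _ hr hC1 hd hC' hC hdiam x ↦
    FarCrosscut.exists_forall_lt_dist hf hinj hr hC1 hd hC' hC hdiam x

end Summit.CriticalPhenomena.CardyFormulaZ2.Cruxes.CardyRigidity.CrossingMartingale

end
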